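import Summits.CriticalPhenomena.SAWScalingLimit.Theorems.SAWTotalPositivityCriticalBubbleBoundDockingDefs
import Literature.Probability.RandomPlanarGeometry.SAWPolygonSurgery

/-!
# The plaquette flip of two vertex-disjoint polygons (line `docking-census-joining`, stub S1)

Crux `stmt-CriticalPhenomena-7117`
(`Summit.CriticalPhenomena.SAWScalingLimit.Theses.SAWTotalPositivity.CriticalBubbleBound`), line
`docking-census-joining`, helper file of the registered stub `stub_dockingInjection`
(objects: `…Theorems.SAWTotalPositivityCriticalBubbleBoundDockingDefs`).

Pure polygon combinatorics (`IsPolygon G E`: the edge set of a cycle), no walks `ω` yet: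

* `walk_edges_mem_of_vertexDisjoint`, `polygon_subset_of_union_eq`, `polygon_pair_unique` — if two
  pairs `(P₁, P₁')`, `(P₂, P₂')` of vertex-disjoint polygons have the same union and `P₁`, `P₂` share
  an edge, then `P₁ = P₂` and `P₁' = P₂'` (the UNFLIP is well defined: the member through the root
  edge is determined as "the component of the root edge");
* `exists_flip` — the PLAQUETTE FLIP (Hammond's join plaquette): for vertex-disjoint polygons
  `X ∋ {q, q+e₀}` and `Y ∋ {q+e₁, q+e₀+e₁}` of `ℤ²`, deleting these two horizontal sides of the unit
  square at `q` and adding its two vertical sides gives ONE polygon with `#X + #Y` edges, which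
  contains every other edge of `X` and `Y`, misses the two horizontal sides, and from which `X ∪ Y`
  is recovered by the inverse flip (an instance of the tree's `IsPolygon.merge` with two one-edge
  connecting paths);
* small lattice facts about `e₀ = (1,0)`, `e₁ = (0,1)` (adjacency, distinctness of the four
  corners `q, q+e₀, q+e₁, q+e₀+e₁` and of the four sides of a plaquette).

Sources: A. Hammond, *An upper bound on the number of self-avoiding polygons via joining*,
Ann. Probab. 46 (2018), §4.1 (join plaquettes); N. Madras, G. Slade, *The Self-Avoiding Walk* (1993),
Definition 3.2.1. Everything here is elementary ("folklore").
-/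

noncomputable section

open Literature.Probability.LatticeModels
open Literature.Probability.RandomPlanarGeometry Literature.Probability.RandomPlanarGeometry.SAW
open scoped BigOperators
open Summit.CriticalPhenomena.SAWScalingLimit.Theorems.CriticalBubbleBound.Negative (e₀)

namespace Summit.CriticalPhenomena.SAWScalingLimit.Theorems.CriticalBubbleBound.Docking

/-! ## Components of a union of two vertex-disjoint edge sets -/

section Generic

variable {V : Type*} {G : SimpleGraph V}

/-- A walk using only edges of `A ∪ B`, `A` and `B` vertex-disjoint, and starting at a vertex of
`A`, uses only edges of `A`. [folklore] -/
theorem walk_edges_mem_of_vertexDisjoint {A B : Finset (Sym2 V)}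
    (hAB : ∀ x, (∃ e ∈ A, x ∈ e) → (∃ e ∈ B, x ∈ e) → False) {u v : V} (w : G.Walk u v)
    (hw : ∀ e ∈ w.edges, e ∈ A ∨ e ∈ B) (hu : ∃ e ∈ A, u ∈ e) : ∀ e ∈ w.edges, e ∈ A := by
  induction w with
  | nil => simp
  | @cons a b c h w' ih =>
    have h1 : s(a, b) ∈ A := by
      rcases hw s(a, b) (by simp) with h1 | h1
      · exact h1
      · exact (hAB a hu ⟨_, h1, Sym2.mem_mk_left _ _⟩).elim
    have ih' := ih (fun e he => hw e (by simp [he])) ⟨_, h1, Sym2.mem_mk_right _ _⟩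
    intro e he
    rw [SimpleGraph.Walk.edges_cons, List.mem_cons] at he
    rcases he with rfl | he
    · exact h1
    · exact ih' e he

/-- Every unordered pair has a member. [folklore] -/
theorem sym2_exists_mem (e : Sym2 V) : ∃ a, a ∈ e :=
  Sym2.ind (fun a b => ⟨a, Sym2.mem_mk_left a b⟩) e

/-- No edge belongs to both members of a vertex-disjoint pair of edge sets. [folklore] -/
theorem notMem_of_vertexDisjoint {A B : Finset (Sym2 V)}
    (hAB : ∀ x, (∃ e ∈ A, x ∈ e) → (∃ e ∈ B, x ∈ e) → False) {e : Sym2 V} (heA : e ∈ A) :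
    e ∉ B := fun heB => by
  obtain ⟨a, ha⟩ := sym2_exists_mem e
  exact hAB a ⟨e, heA, ha⟩ ⟨e, heB, ha⟩

/-- If a polygon `P₁` lies in the union of two vertex-disjoint edge sets `P₂ ∪ P₂'` and shares an
edge with `P₂`, it lies in `P₂` (a cycle is connected). [folklore] -/
theorem polygon_subset_of_union_eq [DecidableEq V] {P₁ P₁' P₂ P₂' : Finset (Sym2 V)}
    (h₁ : IsPolygon G P₁)
    (hd₂ : ∀ x, (∃ e ∈ P₂, x ∈ e) → (∃ e ∈ P₂', x ∈ e) → False)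
    (hU : P₁ ∪ P₁' = P₂ ∪ P₂') {r : Sym2 V} (hr₁ : r ∈ P₁) (hr₂ : r ∈ P₂) : P₁ ⊆ P₂ := by
  obtain ⟨u, c, hc, rfl⟩ := h₁
  have hsub : ∀ e ∈ c.edges, e ∈ P₂ ∨ e ∈ P₂' := fun e he => by
    have : e ∈ c.edges.toFinset ∪ P₁' := Finset.mem_union_left _ (List.mem_toFinset.2 he)
    rwa [hU, Finset.mem_union] at this
  obtain ⟨e', he', hue⟩ : ∃ e ∈ c.edges, u ∈ e :=
    (SimpleGraph.Walk.mem_support_iff_exists_mem_edges_of_not_nil hc.not_nil).1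
      c.start_mem_support
  intro e he
  rw [List.mem_toFinset] at he
  rcases hsub e' he' with h | h
  · exact walk_edges_mem_of_vertexDisjoint hd₂ c hsub ⟨e', h, hue⟩ e he
  · exfalso
    have hd₂' : ∀ x, (∃ e ∈ P₂', x ∈ e) → (∃ e ∈ P₂, x ∈ e) → False := fun x h h' => hd₂ x h' h
    have hall := walk_edges_mem_of_vertexDisjoint hd₂' c (fun e he => (hsub e he).symm)
      ⟨e', h, hue⟩
    exact notMem_of_vertexDisjoint hd₂ hr₂ (hall r (List.mem_toFinset.1 hr₁))

/-- **The unflip is well defined.** Two pairs of vertex-disjoint polygons with the same union whose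
first members share an edge coincide. [folklore] -/
theorem polygon_pair_unique [DecidableEq V] {P₁ P₁' P₂ P₂' : Finset (Sym2 V)}
    (h₁ : IsPolygon G P₁) (h₂ : IsPolygon G P₂)
    (hd₁ : ∀ x, (∃ e ∈ P₁, x ∈ e) → (∃ e ∈ P₁', x ∈ e) → False)
    (hd₂ : ∀ x, (∃ e ∈ P₂, x ∈ e) → (∃ e ∈ P₂', x ∈ e) → False)
    (hU : P₁ ∪ P₁' = P₂ ∪ P₂') {r : Sym2 V} (hr₁ : r ∈ P₁) (hr₂ : r ∈ P₂) :
    P₁ = P₂ ∧ P₁' = P₂' := by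
  have hP : P₁ = P₂ := Finset.Subset.antisymm (polygon_subset_of_union_eq h₁ hd₂ hU hr₁ hr₂)
    (polygon_subset_of_union_eq h₂ hd₁ hU.symm hr₂ hr₁)
  refine ⟨hP, ?_⟩
  subst hP
  ext e
  constructor
  · intro he
    have : e ∈ P₁ ∪ P₂' := by rw [← hU]; exact Finset.mem_union_right _ he
    rcases Finset.mem_union.1 this with h | h
    · exact (notMem_of_vertexDisjoint hd₁ h he).elim
    · exact h
  · intro he
    have : e ∈ P₁ ∪ P₁' := by rw [hU]; exact Finset.mem_union_right _ he
    rcases Finset.mem_union.1 this with h | h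
    · exact (notMem_of_vertexDisjoint hd₂ h he).elim
    · exact h

end Generic

/-! ## The unit vectors `e₀ = (1,0)`, `e₁ = (0,1)` and the four corners of a plaquette -/

/-- `e₀` is the first unit coordinate vector. [folklore] -/
theorem e₀_eq_single : e₀ = Pi.single 0 1 := by
  funext i; fin_cases i <;> rfl

/-- `e₁` is the second unit coordinate vector. [folklore] -/
theorem e₁_eq_single : e₁ = Pi.single 1 1 := by
  funext i; fin_cases i <;> rfl

/-- `q ∼ q + e₀`. [folklore] -/
theorem adj_add_e₀ (q : Site 2) : (zdGraph 2).Adj q (q + e₀) :=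
  (zdGraph_adj_iff _ _).2 ⟨0, Or.inl (by rw [e₀_eq_single])⟩

/-- `q ∼ q + e₁`. [folklore] -/
theorem adj_add_e₁ (q : Site 2) : (zdGraph 2).Adj q (q + e₁) :=
  (zdGraph_adj_iff _ _).2 ⟨1, Or.inl (by rw [e₁_eq_single])⟩

/-- The four corners `q, q+e₀, q+e₁, q+e₀+e₁` of a plaquette are pairwise distinct (compare one
coordinate). [folklore] -/
theorem corners_ne (q : Site 2) :
    q + e₀ ≠ q ∧ q + e₁ ≠ q ∧ q + e₀ + e₁ ≠ q ∧ q + e₀ ≠ q + e₁ ∧ q + e₀ + e₁ ≠ q + e₀ ∧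
      q + e₀ + e₁ ≠ q + e₁ := by
  refine ⟨fun h => ?_, fun h => ?_, fun h => ?_, fun h => ?_, fun h => ?_, fun h => ?_⟩
  · have h' := congrFun h 0
    simp only [Pi.add_apply] at h'
    simp [Negative.e₀] at h'
  · have h' := congrFun h 1
    simp only [Pi.add_apply] at h'
    simp [e₁] at h'
  · have h' := congrFun h 0
    simp only [Pi.add_apply] at h'
    simp [Negative.e₀, e₁] at h'
  · have h' := congrFun h 0
    simp only [Pi.add_apply] at h'
    simp [Negative.e₀, e₁] at h'
  · have h' := congrFun h 1
    simp only [Pi.add_apply] at h'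
    simp [Negative.e₀, e₁] at h'
  · have h' := congrFun h 0
    simp only [Pi.add_apply] at h'
    simp [Negative.e₀, e₁] at h'

/-- The lower side and the left side of a plaquette differ. [folklore] -/
theorem lo_ne_left (q : Site 2) : s(q, q + e₀) ≠ s(q, q + e₁) := by
  obtain ⟨h1, h2, h3, h4, h5, h6⟩ := corners_ne q
  rw [Ne, Sym2.eq_iff]; tauto

/-- The lower side and the right side of a plaquette differ. [folklore] -/
theorem lo_ne_right (q : Site 2) : s(q, q + e₀) ≠ s(q + e₀, q + e₀ + e₁) := by
  obtain ⟨h1, h2, h3, h4, h5, h6⟩ := corners_ne q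
  rw [Ne, Sym2.eq_iff]; tauto

/-- The upper side and the left side of a plaquette differ. [folklore] -/
theorem hi_ne_left (q : Site 2) : s(q + e₁, q + e₀ + e₁) ≠ s(q, q + e₁) := by
  obtain ⟨h1, h2, h3, h4, h5, h6⟩ := corners_ne q
  rw [Ne, Sym2.eq_iff]; tauto

/-- The upper side and the right side of a plaquette differ. [folklore] -/
theorem hi_ne_right (q : Site 2) : s(q + e₁, q + e₀ + e₁) ≠ s(q + e₀, q + e₀ + e₁) := by
  obtain ⟨h1, h2, h3, h4, h5, h6⟩ := corners_ne q
  rw [Ne, Sym2.eq_iff]; tauto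

/-- The upper side and the lower side of a plaquette differ. [folklore] -/
theorem hi_ne_lo (q : Site 2) : s(q + e₁, q + e₀ + e₁) ≠ s(q, q + e₀) := by
  obtain ⟨h1, h2, h3, h4, h5, h6⟩ := corners_ne q
  rw [Ne, Sym2.eq_iff]; tauto

/-- The left side and the right side of a plaquette differ. [folklore] -/
theorem left_ne_right (q : Site 2) : s(q, q + e₁) ≠ s(q + e₀, q + e₀ + e₁) := by
  obtain ⟨h1, h2, h3, h4, h5, h6⟩ := corners_ne q
  rw [Ne, Sym2.eq_iff]; tauto

/-! ## The plaquette flip -/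

/-- **The plaquette flip (join).** Let `X ∋ {q, q+e₀}` and `Y ∋ {q+e₁, q+e₀+e₁}` be vertex-disjoint
polygons of `ℤ²` (the lower and upper sides of the unit square at `q`). Removing these two
horizontal sides from `X ∪ Y` and adding the two vertical sides `{q, q+e₁}`, `{q+e₀, q+e₀+e₁}`
gives a polygon `C` with `#X + #Y` edges containing the two vertical sides and every other edge of
`X` and of `Y`, not containing the two horizontal sides, and the inverse flip of `C` is `X ∪ Y`.
[cite: MadrasSlade1993, Definition 3.2.1] -/
theorem exists_flip {X Y : Finset (Sym2 (Site 2))} {q : Site 2} (hX : IsPolygon (zdGraph 2) X)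
    (hY : IsPolygon (zdGraph 2) Y) (hXY : ∀ x, (∃ e ∈ X, x ∈ e) → (∃ e ∈ Y, x ∈ e) → False)
    (hlo : s(q, q + e₀) ∈ X) (hhi : s(q + e₁, q + e₀ + e₁) ∈ Y) :
    ∃ C : Finset (Sym2 (Site 2)),
      C = insert s(q, q + e₁) (insert s(q + e₀, q + e₀ + e₁)
        (((X ∪ Y).erase s(q, q + e₀)).erase s(q + e₁, q + e₀ + e₁))) ∧
      IsPolygon (zdGraph 2) C ∧ C.card = X.card + Y.card ∧
      s(q, q + e₁) ∈ C ∧ s(q + e₀, q + e₀ + e₁) ∈ C ∧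
      s(q, q + e₀) ∉ C ∧ s(q + e₁, q + e₀ + e₁) ∉ C ∧
      (∀ e ∈ X, e ≠ s(q, q + e₀) → e ∈ C) ∧ (∀ e ∈ Y, e ≠ s(q + e₁, q + e₀ + e₁) → e ∈ C) ∧
      X ∪ Y = insert s(q, q + e₀) (insert s(q + e₁, q + e₀ + e₁)
        ((C.erase s(q, q + e₁)).erase s(q + e₀, q + e₀ + e₁))) := by
  obtain ⟨c1, c2, c3, c4, c5, c6⟩ := corners_ne q
  -- the four corners: `q`, `q + e₀` on `X`, `q + e₁`, `q + e₀ + e₁` on `Y`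
  have hq : ∃ e ∈ X, q ∈ e := ⟨_, hlo, Sym2.mem_mk_left _ _⟩
  have hq₀ : ∃ e ∈ X, q + e₀ ∈ e := ⟨_, hlo, Sym2.mem_mk_right _ _⟩
  have hq₁ : ∃ e ∈ Y, q + e₁ ∈ e := ⟨_, hhi, Sym2.mem_mk_left _ _⟩
  have hq₀₁ : ∃ e ∈ Y, q + e₀ + e₁ ∈ e := ⟨_, hhi, Sym2.mem_mk_right _ _⟩
  have hloY : s(q, q + e₀) ∉ Y := fun h => hXY q hq ⟨_, h, Sym2.mem_mk_left _ _⟩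
  have hhiX : s(q + e₁, q + e₀ + e₁) ∉ X := fun h => hXY _ ⟨_, h, Sym2.mem_mk_left _ _⟩ hq₁
  have hlX : s(q, q + e₁) ∉ X := fun h => hXY _ ⟨_, h, Sym2.mem_mk_right _ _⟩ hq₁
  have hlY : s(q, q + e₁) ∉ Y := fun h => hXY _ hq ⟨_, h, Sym2.mem_mk_left _ _⟩
  have hrX : s(q + e₀, q + e₀ + e₁) ∉ X := fun h => hXY _ ⟨_, h, Sym2.mem_mk_right _ _⟩ hq₀₁
  have hrY : s(q + e₀, q + e₀ + e₁) ∉ Y := fun h => hXY _ hq₀ ⟨_, h, Sym2.mem_mk_left _ _⟩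
  -- the two rungs as one-edge paths and the merge
  let R₁ : (zdGraph 2).Walk q (q + e₁) := (adj_add_e₁ q).toWalk
  let R₂ : (zdGraph 2).Walk (q + e₀) (q + e₀ + e₁) := (adj_add_e₁ (q + e₀)).toWalk
  have hR₁s : ∀ x ∈ R₁.support, x = q ∨ x = q + e₁ := fun x hx => by simpa [R₁] using hx
  have hR₂s : ∀ x ∈ R₂.support, x = q + e₀ ∨ x = q + e₀ + e₁ := fun x hx => by simpa [R₂] using hx
  have hm := hX.merge hY hlo hhi (R₁ := R₁) (R₂ := R₂) (SimpleGraph.Walk.IsPath.of_adj _)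
    (SimpleGraph.Walk.IsPath.of_adj _) hXY
    (fun x hx h => by
      rcases hR₁s x hx with rfl | rfl
      · rfl
      · exact (hXY _ h hq₁).elim)
    (fun x hx h => by
      rcases hR₁s x hx with rfl | rfl
      · exact (hXY _ hq h).elim
      · rfl)
    (fun x hx h => by
      rcases hR₂s x hx with rfl | rfl
      · rfl
      · exact (hXY _ h hq₀₁).elim)
    (fun x hx h => by
      rcases hR₂s x hx with rfl | rfl
      · exact (hXY _ hq₀ h).elim
      · rfl)
    (fun x hx hx' => by
      rcases hR₁s x hx with rfl | rfl <;> rcases hR₂s _ hx' with h | h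
      · exact c1 h.symm
      · exact c3 h.symm
      · exact c4 h.symm
      · exact c6 h.symm)
  have hR₁e : R₁.edges.toFinset = {s(q, q + e₁)} := by simp [R₁]
  have hR₂e : R₂.edges.toFinset = {s(q + e₀, q + e₀ + e₁)} := by simp [R₂]
  have hR₁l : R₁.length = 1 := by simp [R₁]
  have hR₂l : R₂.length = 1 := by simp [R₂]
  rw [hR₁e, hR₂e, hR₁l, hR₂l] at hm
  -- the merged edge set is the flipped set
  have hMC : X.erase s(q, q + e₀) ∪ Y.erase s(q + e₁, q + e₀ + e₁) ∪
      ({s(q, q + e₁)} ∪ {s(q + e₀, q + e₀ + e₁)}) =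
      insert s(q, q + e₁) (insert s(q + e₀, q + e₀ + e₁)
        (((X ∪ Y).erase s(q, q + e₀)).erase s(q + e₁, q + e₀ + e₁))) := by
    ext e
    simp only [Finset.mem_union, Finset.mem_erase, Finset.mem_insert, Finset.mem_singleton]
    have h1 : e ∈ X → e ≠ s(q + e₁, q + e₀ + e₁) := fun h h' => hhiX (h' ▸ h)
    have h2 : e ∈ Y → e ≠ s(q, q + e₀) := fun h h' => hloY (h' ▸ h)
    tauto
  rw [hMC] at hm
  refine ⟨_, rfl, hm.1, by omega, Finset.mem_insert_self _ _,
    Finset.mem_insert_of_mem (Finset.mem_insert_self _ _), ?_, ?_, ?_, ?_, ?_⟩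
  · simp only [Finset.mem_insert, Finset.mem_erase, not_or]
    exact ⟨lo_ne_left q, lo_ne_right q, fun h => h.2.1 rfl⟩
  · simp only [Finset.mem_insert, Finset.mem_erase, not_or]
    exact ⟨hi_ne_left q, hi_ne_right q, fun h => h.1 rfl⟩
  · intro e he hne
    refine Finset.mem_insert_of_mem (Finset.mem_insert_of_mem ?_)
    exact Finset.mem_erase.2 ⟨fun h => hhiX (h ▸ he), Finset.mem_erase.2 ⟨hne,
      Finset.mem_union_left _ he⟩⟩
  · intro e he hne
    refine Finset.mem_insert_of_mem (Finset.mem_insert_of_mem ?_)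
    exact Finset.mem_erase.2 ⟨hne, Finset.mem_erase.2 ⟨fun h => hloY (h ▸ he),
      Finset.mem_union_right _ he⟩⟩
  · have hl : s(q, q + e₁) ∉ insert s(q + e₀, q + e₀ + e₁)
        (((X ∪ Y).erase s(q, q + e₀)).erase s(q + e₁, q + e₀ + e₁)) := by
      simp only [Finset.mem_insert, Finset.mem_erase, Finset.mem_union, not_or]
      exact ⟨left_ne_right q, fun h => h.2.2.elim hlX hlY⟩
    have hr : s(q + e₀, q + e₀ + e₁) ∉
        ((X ∪ Y).erase s(q, q + e₀)).erase s(q + e₁, q + e₀ + e₁) := by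
      simp only [Finset.mem_erase, Finset.mem_union, not_and, not_or]
      exact fun _ _ => ⟨hrX, hrY⟩
    rw [Finset.erase_insert hl, Finset.erase_insert hr]
    have hhi' : s(q + e₁, q + e₀ + e₁) ∈ (X ∪ Y).erase s(q, q + e₀) :=
      Finset.mem_erase.2 ⟨hi_ne_lo q, Finset.mem_union_right _ hhi⟩
    rw [Finset.insert_erase hhi', Finset.insert_erase (Finset.mem_union_left _ hlo)]

/-- **Registered sub-goal `polygonPair_unique_of_rootEdge`** (the unflip is well defined, `ℤ²`
form used by the docking injection): two pairs of vertex-disjoint polygons of `ℤ²` with the same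
union whose first members both contain the root edge coincide. [folklore] -/
theorem polygonPair_unique_of_rootEdge :
    ∀ (P₁ P₁' P₂ P₂' : Finset (Sym2 (Site 2))), IsPolygon (zdGraph 2) P₁ → IsPolygon (zdGraph 2) P₂ →
      (∀ x, (∃ e ∈ P₁, x ∈ e) → (∃ e ∈ P₁', x ∈ e) → False) →
      (∀ x, (∃ e ∈ P₂, x ∈ e) → (∃ e ∈ P₂', x ∈ e) → False) →
      P₁ ∪ P₁' = P₂ ∪ P₂' → rootEdge ∈ P₁ → rootEdge ∈ P₂ → P₁ = P₂ ∧ P₁' = P₂' :=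
  fun _ _ _ _ h₁ h₂ hd₁ hd₂ hU hr₁ hr₂ => polygon_pair_unique h₁ h₂ hd₁ hd₂ hU hr₁ hr₂

end Summit.CriticalPhenomena.SAWScalingLimit.Theorems.CriticalBubbleBound.Docking

end
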